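import Summits.CriticalPhenomena.CardyFormulaZ2.Theses.CardyQContinuation
import Summits.CriticalPhenomena.CardyFormulaZ2.Theorems.CardyQContinuationIsingJetsConformalStubArcLocalisation
import Literature.Probability.LatticeModels.FKIsingQuadrilateralCrossing
import Literature.Probability.LatticeModels.DiscreteRectBoundaryLoop

/-!
# Crux `IsingJetsConformal`, stub `stub_design_lower_gluing`:
# the collar hypotheses of the lower comparison of the `n = 0` sandwich
# (route `CardyQContinuation`, item stmt-CriticalPhenomena-5560)

In the `n = 0` sandwich the LOWER Chelkak–Smirnov quadrilateral lives on the edge set `E = E_δ`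
of all sides of the `δ`-squares contained in the closure of a designed rectilinear conformal
rectangle `Rm` (clause (i)), glued onto the tree's discretisation
`Ω_δ = discreteDomainGraph R.carrier δ` (vertex set `meshDomain`, discrete arcs
`discreteArc R.carrier δ (R.arc j)`) of the conformal rectangle `R`. The continuum design places
`Rm` inside `R` away from the free arcs `R.arc 1 ∪ R.arc 3` (L5), with its black arcs
`Rm.arc 0, Rm.arc 2` sticking out of `closure R` (L3), and with the quantitative localisation
(L67): every point of `closure Rm` that is not `sIn`-deep in `R` is `sOut`-close to `R.arc 0` or
to `R.arc 2`, the black arcs of `Rm` are `sOut`-close to the corresponding arcs of `R`, and no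
point is `2 sOut`-close to both `R.arc 0` and `R.arc 2`. The black vertices of the discrete
quadrilateral are `C δ`-close to the black arcs of `Rm` (clauses (ii₀), (ii₂)).

The landed lower comparison `stub_loopSymmetricLimit_lowerComparison` consumes COLLAR hypotheses
on two edge sets `C₀, C₂`; this file produces them for all small `δ`. With
`r = sOut + (C⁺ + 1) δ` (`C⁺ = max C 0`) we take
`C_j = {e ∈ E | e ∉ E(Ω_δ), both endpoints have mesh point within r of R.arc j}` and check:

1. the two black vertex sets are disjoint (a common vertex would be `2 sOut`-close to both arcs);
2. black vertices are off `meshDomain` (their mesh points are `C δ`-close to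
   `Rm.arc 0 ∪ Rm.arc 2`, which is at positive distance from `closure R`);
3. every non-`Ω_δ` edge of `E` is in `C₀ ∪ C₂`: an endpoint `sIn`-deep in `R` would make it an
   `Ω_δ`-edge (`ArcLocalisation.eventually_adj_discreteDomainGraph`), so by (L67) an endpoint is
   `sOut`-close to one of the arcs and both endpoints are `(sOut + δ)`-close to it;
4. a vertex of a `C₀`-edge having an `Ω_δ`-neighbour is a discrete boundary vertex (the
   `C₀`-edge is a lattice edge that is not an `Ω_δ`-edge) whose mesh point lies in `closure Rm`,
   hence `δ`-far from `R.arc 1 ∪ R.arc 3`, so it is on the discrete arc of `R.arc 0` or of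
   `R.arc 2` (`ArcLocalisation.mem_discreteArc_zero_union_two`); the latter is excluded since
   discrete-arc vertices are within `δ` of their arc and the vertex is `r ≤ 2 sOut`-close to
   `R.arc 0`; symmetrically for `C₂`;
5. no vertex is on a `C₀`-edge and on a `C₂`-edge (separation again);
6. the `E`-edges at a black vertex of arc `0` (resp. `2`) are `C₀`- (resp. `C₂`-) edges: they are
   not `Ω_δ`-edges by (2), and both endpoints are `(sOut + C δ + δ)`-close to the arc.

References: D. Chelkak, S. Smirnov, Invent. Math. 189 (2012), §6; S. Smirnov, C. R. Acad. Sci.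
Paris 333 (2001), §2 (the discretisation).
-/

namespace Summit.CriticalPhenomena.CardyFormulaZ2.Theorems.CardyQContinuation

open Set Metric Filter Topology
open Literature.Probability.LatticeModels
open Literature.Probability.RandomPlanarGeometry
open Literature.Probability.Percolation

noncomputable section

namespace DesignLowerGluing

open DiscreteRect

/-! ### Lattice edges of the designed quadrilateral -/

/-- The corners of a closed face belong to it. [folklore] -/
theorem meshPoint_corner_mem_closedSq (δ : ℝ) (s : Site 2) (j : Fin 4) :
    meshPoint δ (corner s j) ∈ closedSq δ s :=
  subset_convexHull ℝ (Set.range fun j : Fin 4 ↦ meshPoint δ (corner s j)) (mem_range_self j)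

/-- **Shape of the edges of `E`.** An edge of the designed quadrilateral (a side of a `δ`-square
whose closed face lies in `A`) is a lattice edge `ab` of `ℤ²` with both mesh points `δa, δb` in
`A`. [folklore] -/
theorem exists_eq_of_mem {δ : ℝ} {A : Set ℂ} {E : Finset (Sym2 (Site 2))}
    (hE : ∀ e, e ∈ E ↔ ∃ s : Site 2, closedSq δ s ⊆ A ∧
      ∃ j : Fin 4, e = s(corner s j, corner s j + dir j))
    {e : Sym2 (Site 2)} (he : e ∈ E) :
    ∃ a b : Site 2, e = s(a, b) ∧ (zdGraph 2).Adj a b ∧ meshPoint δ a ∈ A ∧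
      meshPoint δ b ∈ A := by
  obtain ⟨s, hs, j, rfl⟩ := (hE _).1 he
  refine ⟨_, _, rfl, adj_add_dir _ _, hs (meshPoint_corner_mem_closedSq δ s j), ?_⟩
  rw [← corner_add_one]
  exact hs (meshPoint_corner_mem_closedSq δ s (j + 1))

/-- Two vertices of a lattice edge have mesh points within `δ` of each other. [folklore] -/
theorem dist_meshPoint_le_of_mem {δ : ℝ} (hδ : 0 < δ) {a b z w : Site 2}
    (hab : (zdGraph 2).Adj a b) (hz : z ∈ s(a, b)) (hw : w ∈ s(a, b)) :
    dist (meshPoint δ z) (meshPoint δ w) ≤ δ := by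
  have h := dist_meshPoint_of_adj (δ := δ) hab
  rw [abs_of_pos hδ] at h
  rw [Sym2.mem_iff] at hz hw
  rcases hz with rfl | rfl <;> rcases hw with rfl | rfl
  · rw [dist_self]; exact hδ.le
  · exact h.le
  · rw [dist_comm]; exact h.le
  · rw [dist_self]; exact hδ.le

/-- Distances to a set from the two vertices of a lattice edge differ by at most `δ`.
[folklore] -/
theorem infDist_le_add_of_mem {δ : ℝ} (hδ : 0 < δ) {a b z w : Site 2}
    (hab : (zdGraph 2).Adj a b) (hz : z ∈ s(a, b)) (hw : w ∈ s(a, b)) (A : Set ℂ) :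
    infDist (meshPoint δ z) A ≤ infDist (meshPoint δ w) A + δ :=
  infDist_le_infDist_add_dist.trans (by gcongr; exact dist_meshPoint_le_of_mem hδ hab hz hw)

/-! ### Metric bookkeeping -/

/-- **Near `Rm.arc j` implies near `R.arc j`.** If a nonempty compact set `K` lies in the open
`s`-neighbourhood of `A`, a point within `t` of `K` is within `s + t` of `A`. [folklore] -/
theorem infDist_lt_add_of_subset {K A : Set ℂ} (hK : IsCompact K) (hKne : K.Nonempty)
    {s t : ℝ} (hKA : K ⊆ {z | infDist z A < s}) {p : ℂ} (hp : infDist p K ≤ t) :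
    infDist p A < s + t := by
  obtain ⟨a, ha, hpa⟩ := hK.exists_infDist_eq_dist hKne p
  have h1 := infDist_le_infDist_add_dist (s := A) (x := p) (y := a)
  have h2 : infDist a A < s := hKA ha
  rw [← hpa] at h1
  linarith

/-- **Black vertices are off `meshDomain`.** If every point of `closure Ω` is at distance `> ρ`
from `K`, a site whose mesh point is within `t < ρ` of `K` is not a vertex of `Ω_δ` (vertices of
`Ω_δ` have their mesh point in `Ω`). [folklore] -/
theorem not_mem_meshDomain_of_infDist_le {Ω K : Set ℂ} {δ ρ t : ℝ}
    (hfar : ∀ w ∈ closure Ω, ρ < infDist w K) {x : Site 2}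
    (hx : infDist (meshPoint δ x) K ≤ t) (ht : t < ρ) : x ∉ meshDomain Ω δ := fun hxD => by
  have hxΩ : meshPoint δ x ∈ Ω := meshDomain_subset_meshVertices _ _ hxD
  have h1 := hfar _ (subset_closure hxΩ)
  linarith

/-! ### The clauses -/

section Clauses

variable {R Rm : ConformalRectangle} {δ sOut r : ℝ} {E : Finset (Sym2 (Site 2))}

/-- **Cover (clause 3).** For an edge of `E` that is not an edge of `Ω_δ`, both endpoints are
within `r` of `R.arc 0`, or both are within `r` of `R.arc 2` — provided lattice edges from
`sIn`-deep points are `Ω_δ`-edges, non-deep points of `closure Rm` are `sOut`-close to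
`R.arc 0 ∪ R.arc 2`, and `sOut + δ ≤ r`. [folklore] -/
theorem near_or_near_of_not_mem_edgeSet (hδ : 0 < δ)
    (hE : ∀ e, e ∈ E ↔ ∃ s : Site 2, closedSq δ s ⊆ closure Rm.carrier ∧
      ∃ j : Fin 4, e = s(corner s j, corner s j + dir j))
    {sIn : ℝ}
    (hloc : ∀ x y : Site 2, meshPoint δ x ∈ R.carrier →
      sIn ≤ infDist (meshPoint δ x) (frontier R.carrier) → (zdGraph 2).Adj x y →
      (discreteDomainGraph R.carrier δ).Adj x y)
    (hcov : closure Rm.carrier \ {z | z ∈ R.carrier ∧ sIn ≤ infDist z (frontier R.carrier)} ⊆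
      {z | infDist z (R.arc 0) < sOut} ∪ {z | infDist z (R.arc 2) < sOut})
    (hsr : sOut + δ ≤ r) {e : Sym2 (Site 2)} (heE : e ∈ E)
    (heG : e ∉ (discreteDomainGraph R.carrier δ).edgeSet) :
    (∀ z ∈ e, infDist (meshPoint δ z) (R.arc 0) ≤ r) ∨
      (∀ z ∈ e, infDist (meshPoint δ z) (R.arc 2) ≤ r) := by
  obtain ⟨a, b, rfl, hab, ha, -⟩ := exists_eq_of_mem hE heE
  have hnd : meshPoint δ a ∉ {z | z ∈ R.carrier ∧ sIn ≤ infDist z (frontier R.carrier)} := by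
    rintro ⟨haR, haIn⟩
    exact heG ((SimpleGraph.mem_edgeSet _).2 (hloc a b haR haIn hab))
  rcases hcov ⟨ha, hnd⟩ with h | h
  · refine Or.inl fun z hz => ?_
    have := infDist_le_add_of_mem hδ hab hz (Sym2.mem_mk_left a b) (R.arc 0)
    simp only [mem_setOf_eq] at h
    linarith
  · refine Or.inr fun z hz => ?_
    have := infDist_le_add_of_mem hδ hab hz (Sym2.mem_mk_left a b) (R.arc 2)
    simp only [mem_setOf_eq] at h
    linarith

/-- **Attachment (clause 4).** A vertex `x` of a collar edge of the arc `R.arc j` (an `E`-edge,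
not an `Ω_δ`-edge, with both endpoints within `r` of `R.arc j`) that has an `Ω_δ`-neighbour lies
on the discrete arc of `R.arc j`: it is a discrete boundary vertex, `δ`-far from
`R.arc 1 ∪ R.arc 3` (its mesh point lies in `closure Rm`), hence on the discrete arc of `R.arc j`
or of the opposite arc `R.arc j'`, and the latter would put it within `δ ≤ 2 sOut` of `R.arc j'`
and within `r ≤ 2 sOut` of `R.arc j`. [folklore] -/
theorem mem_discreteArc_of_near (hδ : 0 < δ)
    (hE : ∀ e, e ∈ E ↔ ∃ s : Site 2, closedSq δ s ⊆ closure Rm.carrier ∧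
      ∃ j : Fin 4, e = s(corner s j, corner s j + dir j))
    {j j' : Fin 4}
    (hcover : ∀ x ∈ meshBoundary R.carrier δ,
      δ < infDist (meshPoint δ x) (R.arc 1 ∪ R.arc 3) →
      x ∈ discreteArc R.carrier δ (R.arc j) ∪ discreteArc R.carrier δ (R.arc j'))
    (hsep : ∀ z : ℂ, infDist z (R.arc j) ≤ 2 * sOut → infDist z (R.arc j') ≤ 2 * sOut → False)
    (hr2 : r ≤ 2 * sOut) (hδ2 : δ ≤ 2 * sOut) {ρ₅ : ℝ}
    (hfar₅ : ∀ w ∈ closure Rm.carrier, ρ₅ < infDist w (R.arc 1 ∪ R.arc 3)) (h5 : δ < ρ₅)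
    {x : Site 2} {e : Sym2 (Site 2)} (heE : e ∈ E)
    (heG : e ∉ (discreteDomainGraph R.carrier δ).edgeSet)
    (hnear : ∀ z ∈ e, infDist (meshPoint δ z) (R.arc j) ≤ r) (hx : x ∈ e)
    (hadj : ∃ y, (discreteDomainGraph R.carrier δ).Adj x y) :
    x ∈ discreteArc R.carrier δ (R.arc j) := by
  obtain ⟨a, b, rfl, hab, ha, hb⟩ := exists_eq_of_mem hE heE
  obtain ⟨y, hy⟩ := hadj
  have hxD : x ∈ meshDomain R.carrier δ := (discreteDomainGraph_adj_iff.1 hy).2.1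
  obtain ⟨x', hxx', hG, hxA⟩ : ∃ x', (zdGraph 2).Adj x x' ∧
      ¬ (discreteDomainGraph R.carrier δ).Adj x x' ∧ meshPoint δ x ∈ closure Rm.carrier := by
    rcases Sym2.mem_iff.1 hx with rfl | rfl
    · exact ⟨b, hab, fun h => heG ((SimpleGraph.mem_edgeSet _).2 h), ha⟩
    · exact ⟨a, hab.symm, fun h => heG ((SimpleGraph.mem_edgeSet _).2 h.symm), hb⟩
  have hxB : x ∈ meshBoundary R.carrier δ := ⟨hxD, x', hxx', hG⟩
  have h13 : δ < infDist (meshPoint δ x) (R.arc 1 ∪ R.arc 3) := h5.trans (hfar₅ _ hxA)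
  rcases hcover x hxB h13 with h | h
  · exact h
  · exfalso
    have h1 := infDist_le_of_mem_discreteArc R.isOpen h
    rw [abs_of_pos hδ] at h1
    exact hsep _ ((hnear x hx).trans hr2) (h1.trans hδ2)

/-- **Black edges (clause 6).** An `E`-edge at a vertex `x ∉ meshDomain` whose mesh point is
within `t` of `A`, with `t + δ ≤ r`, is not an `Ω_δ`-edge and has both endpoints within `r` of
`A`. [folklore] -/
theorem not_mem_edgeSet_and_near (hδ : 0 < δ)
    (hE : ∀ e, e ∈ E ↔ ∃ s : Site 2, closedSq δ s ⊆ closure Rm.carrier ∧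
      ∃ j : Fin 4, e = s(corner s j, corner s j + dir j))
    {A : Set ℂ} {t : ℝ} {x : Site 2} (hxA : infDist (meshPoint δ x) A < t) (htr : t + δ ≤ r)
    (hxD : x ∉ meshDomain R.carrier δ) {e : Sym2 (Site 2)} (heE : e ∈ E) (hx : x ∈ e) :
    e ∉ (discreteDomainGraph R.carrier δ).edgeSet ∧
      ∀ z ∈ e, infDist (meshPoint δ z) A ≤ r := by
  obtain ⟨a, b, rfl, hab, -, -⟩ := exists_eq_of_mem hE heE
  refine ⟨fun he => hxD ?_, fun z hz => ?_⟩
  · have h := discreteDomainGraph_adj_iff.1 ((SimpleGraph.mem_edgeSet _).1 he)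
    rcases Sym2.mem_iff.1 hx with rfl | rfl
    · exact h.2.1
    · exact h.2.2
  · have := infDist_le_add_of_mem hδ hab hz hx A
    linarith

end Clauses

end DesignLowerGluing

open DesignLowerGluing

/-- **Stub `stub_design_lower_gluing`** of the skeleton of the crux `IsingJetsConformal`
(stmt-CriticalPhenomena-5560): for all small mesh `δ`, the collar hypotheses of the lower
comparison `stub_loopSymmetricLimit_lowerComparison` hold for the designed quadrilateral on the
sides of the `δ`-squares inside `closure Rm`, with the collars
`C_j = {e ∈ E | e ∉ E(Ω_δ), both endpoints within sOut + (C⁺ + 1) δ of R.arc j}`; see the module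
docstring for the six checks. (Chelkak–Smirnov 2012, §6; Smirnov 2001, §2.) [folklore] -/
theorem stub_design_lower_gluing : (∀ (R Rm : Literature.Probability.RandomPlanarGeometry.ConformalRectangle), Rm.arc 0 ∪ Rm.arc 2 ⊆ (closure R.carrier)ᶜ → closure Rm.carrier ∩ (R.arc 1 ∪ R.arc 3) = ∅ → (∃ sIn sOut : ℝ, 0 < sIn ∧ 0 < sOut ∧ closure Rm.carrier \ {z | z ∈ R.carrier ∧ sIn ≤ Metric.infDist z (frontier R.carrier)} ⊆ {z | Metric.infDist z (R.arc 0) < sOut} ∪ {z | Metric.infDist z (R.arc 2) < sOut} ∧ Rm.arc 0 ⊆ {z | Metric.infDist z (R.arc 0) < sOut} ∧ Rm.arc 2 ⊆ {z | Metric.infDist z (R.arc 2) < sOut} ∧ ∀ z : ℂ, Metric.infDist z (R.arc 0) ≤ 2 * sOut → Metric.infDist z (R.arc 2) ≤ 2 * sOut → False) → ∀ C : ℝ, ∀ᶠ δ in nhdsWithin (0 : ℝ) (Set.Ioi 0), ∀ (E : Finset (Sym2 (Literature.Probability.LatticeModels.Site 2))) (d₀ : Literature.Probability.LatticeModels.Site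 2 × Fin 4) (n : Fin 4 → ℕ), (∀ e, e ∈ E ↔ ∃ s : Literature.Probability.LatticeModels.Site 2, Literature.Probability.LatticeModels.DiscreteRect.closedSq δ s ⊆ closure Rm.carrier ∧ ∃ j : Fin 4, e = s(Literature.Probability.LatticeModels.DiscreteRect.corner s j, Literature.Probability.LatticeModels.DiscreteRect.corner s j + Literature.Probability.LatticeModels.DiscreteRect.dir j)) → (∀ x ∈ Literature.Probability.LatticeModels.DiscreteRect.blackVerts E d₀ n 0, Metric.infDist (Literature.Probability.LatticeModels.meshPoint δ x) (Rm.arc 0) ≤ C * δ) → (∀ x ∈ Literature.Probability.LatticeModels.DiscreteRect.blackVerts E d₀ n 2, Metric.infDist (Literature.Probability.LatticeModels.meshPoint δ x) (Rm.arc 2) ≤ C * δ) → ∃ (C₀ C₂ : Set (Sym2 (Literature.Probability.LatticeModels.Site 2))), Disjoint (Literature.Probability.LatticeModels.DiscreteRect.blackVerts E d₀ n 0) (Literature.Probability.LatticeModels.DiscreteRect.blackVerts E d₀ n 2) ∧ (∀ v ∈ Literature.Probability.LatticeModels.DiscreteRect.blackVerts E d₀ n 0 ∪ Literature.Probability.LatticeModels.DiscreteRect.blackVerts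 E d₀ n 2, v ∉ Literature.Probability.LatticeModels.meshDomain R.carrier δ) ∧ (∀ e ∈ E, e ∉ (Literature.Probability.LatticeModels.discreteDomainGraph R.carrier δ).edgeSet → e ∈ C₀ ∪ C₂) ∧ (∀ x : Literature.Probability.LatticeModels.Site 2, (∃ e ∈ C₀, x ∈ e) → (∃ y, (Literature.Probability.LatticeModels.discreteDomainGraph R.carrier δ).Adj x y) → x ∈ Literature.Probability.LatticeModels.discreteArc R.carrier δ (R.arc 0)) ∧ (∀ x : Literature.Probability.LatticeModels.Site 2, (∃ e ∈ C₂, x ∈ e) → (∃ y, (Literature.Probability.LatticeModels.discreteDomainGraph R.carrier δ).Adj x y) → x ∈ Literature.Probability.LatticeModels.discreteArc R.carrier δ (R.arc 2)) ∧ (∀ x : Literature.Probability.LatticeModels.Site 2, (∃ e ∈ C₀, x ∈ e) → ¬ ∃ e ∈ C₂, x ∈ e) ∧ (∀ x ∈ Literature.Probability.LatticeModels.DiscreteRect.blackVerts E d₀ n 0, ∀ e ∈ E, x ∈ e → e ∈ C₀) ∧ (∀ y ∈ Literature.Probability.LatticeModels.DiscreteRect.blackVerts E d₀ n 2, ∀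 e ∈ E, y ∈ e → e ∈ C₂)) := by
  intro R Rm hL3 hL5 hL67 C
  obtain ⟨sIn, sOut, hsIn, hsOut, hcov, hA0, hA2, hsep⟩ := hL67
  -- `closure R` is at positive distance from the black arcs of `Rm` (L3)
  obtain ⟨ρ₃, hρ₃, hfar₃⟩ :
      ∃ ρ > 0, ∀ w ∈ closure R.carrier, ρ < infDist w (Rm.arc 0 ∪ Rm.arc 2) :=
    exists_pos_forall_lt_infDist R.isBounded.isCompact_closure
      ((Rm.isClosed_arc 0).union (Rm.isClosed_arc 2))
      (Set.disjoint_right.2 fun w hw => hL3 hw) ⟨_, mem_union_left _ (Rm.pt_mem_arc_self 0)⟩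
  -- `closure Rm` is at positive distance from the free arcs of `R` (L5)
  obtain ⟨ρ₅, hρ₅, hfar₅⟩ :
      ∃ ρ > 0, ∀ w ∈ closure Rm.carrier, ρ < infDist w (R.arc 1 ∪ R.arc 3) :=
    exists_pos_forall_lt_infDist Rm.isBounded.isCompact_closure
      ((R.isClosed_arc 1).union (R.isClosed_arc 3))
      (Set.disjoint_iff_inter_eq_empty.2 hL5) ⟨_, mem_union_left _ (R.pt_mem_arc_self 1)⟩
  obtain ⟨C', hC'0, hCC'⟩ : ∃ C' : ℝ, 0 ≤ C' ∧ C ≤ C' :=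
    ⟨max C 0, le_max_right _ _, le_max_left _ _⟩
  have hmpos : 0 < min (min ρ₃ ρ₅) sOut := lt_min (lt_min hρ₃ hρ₅) hsOut
  have hC'2 : (0 : ℝ) < C' + 2 := by linarith
  have hδ₀ : 0 < min (min ρ₃ ρ₅) sOut / (C' + 2) := div_pos hmpos hC'2
  filter_upwards [ArcLocalisation.eventually_adj_discreteDomainGraph R hsIn, Ioo_mem_nhdsGT hδ₀]
    with δ hloc hδI
  obtain ⟨hδ, hδlt⟩ := hδI
  have hkey : δ * (C' + 2) < min (min ρ₃ ρ₅) sOut := (lt_div_iff₀ hC'2).1 hδlt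
  have hm3 : min (min ρ₃ ρ₅) sOut ≤ ρ₃ := (min_le_left _ _).trans (min_le_left _ _)
  have hm5 : min (min ρ₃ ρ₅) sOut ≤ ρ₅ := (min_le_left _ _).trans (min_le_right _ _)
  have hmS : min (min ρ₃ ρ₅) sOut ≤ sOut := min_le_right _ _
  have hC'δ : 0 ≤ C' * δ := mul_nonneg hC'0 hδ.le
  have h3 : C' * δ < ρ₃ := by linarith
  have h5 : δ < ρ₅ := by linarith
  -- the collar radius
  obtain ⟨r, hr⟩ : ∃ r : ℝ, r = sOut + (C' + 1) * δ := ⟨_, rfl⟩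
  have hr2 : r ≤ 2 * sOut := by rw [hr]; linarith
  have hδ2 : δ ≤ 2 * sOut := by linarith
  have hsr : sOut + δ ≤ r := by rw [hr]; linarith
  have htr : sOut + C' * δ + δ ≤ r := by rw [hr]; linarith
  intro E d₀ n hE hB0 hB2
  -- black vertices are `(sOut + C⁺ δ)`-close to the corresponding arcs of `R`
  have hB0' : ∀ x ∈ DiscreteRect.blackVerts E d₀ n 0,
      infDist (meshPoint δ x) (R.arc 0) < sOut + C' * δ := fun x hx =>
    infDist_lt_add_of_subset (Rm.isCompact_arc 0) ⟨_, Rm.pt_mem_arc_self 0⟩ hA0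
      ((hB0 x hx).trans (mul_le_mul_of_nonneg_right hCC' hδ.le))
  have hB2' : ∀ x ∈ DiscreteRect.blackVerts E d₀ n 2,
      infDist (meshPoint δ x) (R.arc 2) < sOut + C' * δ := fun x hx =>
    infDist_lt_add_of_subset (Rm.isCompact_arc 2) ⟨_, Rm.pt_mem_arc_self 2⟩ hA2
      ((hB2 x hx).trans (mul_le_mul_of_nonneg_right hCC' hδ.le))
  -- black vertices are off `meshDomain` (clause 2)
  have hBD : ∀ v ∈ DiscreteRect.blackVerts E d₀ n 0 ∪ DiscreteRect.blackVerts E d₀ n 2,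
      v ∉ meshDomain R.carrier δ := by
    rintro v (hv | hv)
    · exact not_mem_meshDomain_of_infDist_le hfar₃
        ((infDist_le_infDist_of_subset subset_union_left ⟨_, Rm.pt_mem_arc_self 0⟩).trans
          ((hB0 v hv).trans (mul_le_mul_of_nonneg_right hCC' hδ.le))) h3
    · exact not_mem_meshDomain_of_infDist_le hfar₃
        ((infDist_le_infDist_of_subset subset_union_right ⟨_, Rm.pt_mem_arc_self 2⟩).trans
          ((hB2 v hv).trans (mul_le_mul_of_nonneg_right hCC' hδ.le))) h3
  refine ⟨{e | e ∈ E ∧ e ∉ (discreteDomainGraph R.carrier δ).edgeSet ∧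
      ∀ z ∈ e, infDist (meshPoint δ z) (R.arc 0) ≤ r},
    {e | e ∈ E ∧ e ∉ (discreteDomainGraph R.carrier δ).edgeSet ∧
      ∀ z ∈ e, infDist (meshPoint δ z) (R.arc 2) ≤ r},
    ?_, hBD, ?_, ?_, ?_, ?_, ?_, ?_⟩
  · -- clause 1: the black vertex sets are disjoint
    exact Set.disjoint_left.2 fun x hx0 hx2 =>
      hsep _ (by linarith [hB0' x hx0]) (by linarith [hB2' x hx2])
  · -- clause 3: non-`Ω_δ` edges of `E` are collar edges
    intro e heE heG
    rcases near_or_near_of_not_mem_edgeSet hδ hE hloc hcov hsr heE heG with h | h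
    · exact Or.inl ⟨heE, heG, h⟩
    · exact Or.inr ⟨heE, heG, h⟩
  · -- clause 4: attachment of `C₀`
    rintro x ⟨e, ⟨heE, heG, hnear⟩, hx⟩ hadj
    exact mem_discreteArc_of_near hδ hE
      (fun x hx h => ArcLocalisation.mem_discreteArc_zero_union_two R hδ hx h) hsep hr2 hδ2
      hfar₅ h5 heE heG hnear hx hadj
  · -- clause 4: attachment of `C₂`
    rintro x ⟨e, ⟨heE, heG, hnear⟩, hx⟩ hadj
    exact mem_discreteArc_of_near hδ hE
      (fun x hx h => Or.symm (ArcLocalisation.mem_discreteArc_zero_union_two R hδ hx h))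
      (fun z h2 h0 => hsep z h0 h2) hr2 hδ2 hfar₅ h5 heE heG hnear hx hadj
  · -- clause 5: no vertex sees both collars
    rintro x ⟨e, ⟨-, -, h0⟩, hx⟩ ⟨e', ⟨-, -, h2⟩, hx'⟩
    exact hsep _ ((h0 x hx).trans hr2) ((h2 x hx').trans hr2)
  · -- clause 6: edges at black vertices of arc `0`
    intro x hx e heE hxe
    exact ⟨heE, not_mem_edgeSet_and_near hδ hE (hB0' x hx) htr (hBD x (Or.inl hx)) heE hxe⟩
  · -- clause 6: edges at black vertices of arc `2`
    intro y hy e heE hye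
    exact ⟨heE, not_mem_edgeSet_and_near hδ hE (hB2' y hy) htr (hBD y (Or.inr hy)) heE hye⟩

end

end Summit.CriticalPhenomena.CardyFormulaZ2.Theorems.CardyQContinuation
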